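import Summits.NavierStokesRegularity.NavierStokesRegularity.Theorems.ExtremiserTransienceNearExtremalTransienceCanonical
import HarnessLib

/-!
# Route `ExtremiserTransience`, crux `NearExtremalTransiencePerFlow` (stmt-NavierStokesRegularity-26567),
# LINE g7-β `zone_transversality`: THE VOCABULARY OF THE LINE (texts of record)

Texts of record, VERBATIM §0 of the registered skeleton
`Summits/NavierStokesRegularity/NavierStokesRegularity/Cruxes/NearExtremalTransiencePerFlow/Lines/zone_transversality.lean`
(planner ns-idea-5 g7, commit 63dbc6d0817d), so that the registered stubs Z1 `stub_sojournBound`, Z2 `stub_zoneLipschitz`,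
Z3 `stub_efficiencyContinuous` — whose registered signatures are phrased with `IsViolator` and `IsMinimalCoeff` — can be
landed as Theorems files with their signatures unchanged (a Theorems file may not import a `Cruxes/` skeleton):

* `PFC T u` — the per-flow CONCLUSION of the crux `NearExtremalTransiencePerFlow` for the flow `u` on `[0,T)` (verbatim);
* `IsViolator C ν T u p` — the VIOLATOR FRAME: a flow satisfying every hypothesis of the crux whose per-flow conclusion fails;
* `IsMinimalCoeff T u k₀` — `k₀` is a minimal measurable depletion coefficient of `u` on `[0,T)`: exactly the two properties
  delivered by the landed `DepletionLadder.exists_canonical_coefficient` (flow-wise clause on `[0,T)` + minimality).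

The three definitions are definitionally equal to the skeleton's (same bodies), so a stub proved against this file closes the
skeleton's `sorry` by `exact`.  Open statements are NOT restated here (no `Prop` placeholders of Z1–Z4); the stubs land in
`Theorems/ExtremiserTransienceNearExtremalTransiencePerFlowStub*.lean`.
HONEST FRAMING: definitions only; nothing about Navier–Stokes regularity or blow-up is proved; no summit is proved by a line.
-/

noncomputable section

open scoped Topology InnerProductSpace RealInnerProductSpace ENNReal ContDiff
open MeasureTheory Filter Set
open Literature.Analysis.FluidPDE

namespace Summit.NavierStokesRegularity.NavierStokesRegularity.Theorems.NearExtremalTransiencePerFlow.ZoneTransversality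

-- the summit's namespace `Summit.NavierStokesRegularity.NavierStokesRegularity` repeats the problem name by convention (D-0017)
set_option linter.dupNamespace false

/-- The per-flow CONCLUSION of the crux `NearExtremalTransiencePerFlow` (stmt-NavierStokesRegularity-26567) for the flow `u`
on `[0,T)`, verbatim: the flow has ITS OWN exponent `θ ∈ [0,1)` such that for every universal depletion constant `κ` there are
an onset `t₁`, a measurable flow-wise depletion coefficient `k ∈ [0,1]` and `B` with
`∫_{t₁}^t k²/(T−τ) dτ ≤ (θκ)²·log((T−t₁)/(T−t)) + B` on `[t₁,T)`.  (Skeleton `zone_transversality.lean` §0, verbatim.) -/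
def PFC (T : ℝ) (u : ℝ → EuclideanSpace ℝ (Fin 3) → EuclideanSpace ℝ (Fin 3)) : Prop :=
  ∃ θ : ℝ, 0 ≤ θ ∧ θ < 1 ∧ ∀ κ : ℝ, (∀ (v : EuclideanSpace ℝ (Fin 3) → EuclideanSpace ℝ (Fin 3)) (M B : ℝ), ContDiff ℝ (⊤ : ℕ∞) v → Literature.Analysis.FluidPDE.VectorCalculus.IsDivFree v → (∀ x, ‖v x‖ ≤ M) → (∀ x, ‖fderiv ℝ v x‖ ≤ B) → (∫⁻ x, ‖iteratedFDeriv ℝ 0 v x‖ₑ ^ 2 < ⊤) → (∫⁻ x, ‖iteratedFDeriv ℝ 1 v x‖ₑ ^ 2 < ⊤) → (∫⁻ x, ‖iteratedFDeriv ℝ 2 v x‖ₑ ^ 2 < ⊤) → |∫ x, ⟪Literature.Analysis.FluidPDE.curl v x, fderiv ℝ v x (Literature.Analysis.FluidPDE.curl v x)⟫_ℝ| ≤ κ * M * Real.sqrt (∫ x, ‖Literature.Analysis.FluidPDE.curl v x‖ ^ 2) * Real.sqrt (∫ x, Literature.Analysis.FluidPDE.frobeniusNormSq (fderiv ℝ (Literature.Analysis.FluidPDE.curl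 v) x))) → ∃ t₁ ∈ Set.Ico 0 T, ∃ (k : ℝ → ℝ) (B : ℝ), Measurable k ∧ (∀ τ, 0 ≤ k τ ∧ k τ ≤ 1) ∧ (∀ t ∈ Set.Ico t₁ T, ∀ M : ℝ, (∀ x, ‖u t x‖ ≤ M) → |∫ x, ⟪Literature.Analysis.FluidPDE.curl (u t) x, fderiv ℝ (u t) x (Literature.Analysis.FluidPDE.curl (u t) x)⟫_ℝ| ≤ k t * M * Real.sqrt (∫ x, ‖Literature.Analysis.FluidPDE.curl (u t) x‖ ^ 2) * Real.sqrt (∫ x, Literature.Analysis.FluidPDE.frobeniusNormSq (fderiv ℝ (Literature.Analysis.FluidPDE.curl (u t)) x))) ∧ (∀ t ∈ Set.Ico t₁ T, ∫ τ in t₁..t, k τ ^ 2 / (T - τ) ≤ (θ * κ) ^ 2 * Real.log ((T - t₁) / (T - t)) + B)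

/-- The VIOLATOR FRAME (contrapositive of the crux, as in items 27822/28318): a flow satisfying every hypothesis of
`NearExtremalTransiencePerFlow` — `0 < C`, `0 < ν`, `0 < T`, classical on `[0,T) × ℝ³`, Leray–Hopf from its rapidly decaying
datum, eventual Type-I rate `√(T−t)‖u(t,x)‖ ≤ C√ν`, no smooth extension past `T` — whose per-flow conclusion `PFC T u` fails.
(Skeleton `zone_transversality.lean` §0, verbatim.) -/
def IsViolator (C ν T : ℝ) (u : ℝ → EuclideanSpace ℝ (Fin 3) → EuclideanSpace ℝ (Fin 3))
    (p : ℝ → EuclideanSpace ℝ (Fin 3) → ℝ) : Prop :=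
  0 < C ∧ 0 < ν ∧ 0 < T ∧ IsClassicalNSSolutionOn (Set.Ico 0 T) ν 0 u p ∧ IsLerayHopfOn T ν 0 (u 0) u ∧
    HasRapidSpatialDecay (u 0) ∧ (∀ᶠ t in 𝓝[<] T, ∀ x, Real.sqrt (T - t) * ‖u t x‖ ≤ C * Real.sqrt ν) ∧
    ¬ HasSmoothExtensionPast ν 0 u T ∧ ¬ PFC T u

/-- `k₀` is a MINIMAL measurable depletion coefficient of `u` on `[0,T)`: `k₀` measurable with values in `[0,1]`, the
flow-wise clause `|∫⟪curl u(t), Du(t) curl u(t)⟫| ≤ k₀(t)·M·‖curl u(t)‖₂·‖∇curl u(t)‖₂` for every `t ∈ [0,T)` and every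
bound `M` of `|u(t)|`, and minimality: `k₀(t) ≤ c` for every `c ≥ 0` satisfying the clause at `t` — exactly the two properties
delivered by the landed `DepletionLadder.exists_canonical_coefficient`.  (Skeleton `zone_transversality.lean` §0, verbatim.) -/
def IsMinimalCoeff (T : ℝ) (u : ℝ → EuclideanSpace ℝ (Fin 3) → EuclideanSpace ℝ (Fin 3)) (k₀ : ℝ → ℝ) : Prop :=
  Measurable k₀ ∧ (∀ τ, 0 ≤ k₀ τ ∧ k₀ τ ≤ 1) ∧
    (∀ t ∈ Set.Ico 0 T, ∀ M : ℝ, (∀ x, ‖u t x‖ ≤ M) →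
      |∫ x, ⟪curl (u t) x, fderiv ℝ (u t) x (curl (u t) x)⟫_ℝ| ≤
        k₀ t * M * Real.sqrt (∫ x, ‖curl (u t) x‖ ^ 2) * Real.sqrt (∫ x, frobeniusNormSq (fderiv ℝ (curl (u t)) x))) ∧
    (∀ t ∈ Set.Ico 0 T, ∀ c : ℝ, 0 ≤ c →
      (∀ M : ℝ, (∀ x, ‖u t x‖ ≤ M) →
        |∫ x, ⟪curl (u t) x, fderiv ℝ (u t) x (curl (u t) x)⟫_ℝ| ≤
          c * M * Real.sqrt (∫ x, ‖curl (u t) x‖ ^ 2) * Real.sqrt (∫ x, frobeniusNormSq (fderiv ℝ (curl (u t)) x))) →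
      k₀ t ≤ c)

/-- Read-back: the canonical coefficient of `DepletionLadder.exists_canonical_coefficient` IS a minimal coefficient in the sense
of `IsMinimalCoeff` (the two clauses are literally its conclusions), so `IsMinimalCoeff T u` is inhabited for every classical
Leray–Hopf rapidly-decaying-datum flow on `[0,T)`. -/
theorem exists_isMinimalCoeff {ν T : ℝ} (hν : 0 < ν) (hT : 0 < T)
    {u : ℝ → EuclideanSpace ℝ (Fin 3) → EuclideanSpace ℝ (Fin 3)} {p : ℝ → EuclideanSpace ℝ (Fin 3) → ℝ}
    (hsol : IsClassicalNSSolutionOn (Set.Ico 0 T) ν 0 u p) (hLH : IsLerayHopfOn T ν 0 (u 0) u)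
    (hdec : HasRapidSpatialDecay (u 0)) : ∃ k₀ : ℝ → ℝ, IsMinimalCoeff T u k₀ := by
  obtain ⟨k₀, hm, h01, hcl, hmin⟩ := DepletionLadder.exists_canonical_coefficient hν hT hsol hLH hdec
  exact ⟨k₀, hm, h01, hcl, hmin⟩

end Summit.NavierStokesRegularity.NavierStokesRegularity.Theorems.NearExtremalTransiencePerFlow.ZoneTransversality

end
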